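import Summits.QuantumFields.BalabanUV.Beta.EriceRemainderEnclosureHistoryAutonomyComparisonAgeCompositionStaticChainFluidDomination

/-!
# EriceRemainderEnclosureHistoryAutonomyComparisonAgeCompositionStaticChainRefinement — (E73c) REFINEMENT MONOTONICITY of the constant-coefficient spike:
# splitting a member into two consecutive pieces never decreases the compounding when `κ ≥ a` — the discrete counterpart of (E73a)'s Riccati
# inequality; so the fluid is the SUPREMUM over subdivisions and the continuum (`z → ∞`) is the worst case of the budget-form chain's dense clusters

Cell `pub-balaban`, β-function sub-cell, BINDER row D4 «RemainderConst leaves for Bałaban's split» (`HOME/BINDER-OWNERS.md`; owner lineage `b2b-balaban-beta-an4`;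
this file by co-owner #2 lineage `b2b-balaban-beta-d4-p2`, generation 64), β-FLOW TEAM duty (1), FREEZE (0) honoured (def-free; imports (E73a)
`…StaticChainFluidDomination` only to sit next to it in the import graph — nothing of it is used; pure real algebra).

HONEST FRAMING (page 1, verbatim and binding).  *"Discharging BetaPertH makes Bałaban's UV stability UNCONDITIONAL — a real constructive-QFT result; it is
NOT the continuum limit and NOT the Clay problem."*  THIS FILE DISCHARGES NOTHING OF THE KIND.  Elementary algebra of one and two compounding factors of the
census's own FIRST-ORDER static chain over NOT-IN-PRINT binders; the form, signs, ages and moments of Bałaban's (1.22) limit functional are NOT PRINTED ([I]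
p. 298; GAPS G-t4-U2-1∕-2) and NOT asserted.  Row D4 class UNCHANGED (critical-path width 0; instance 0∕1; D4 DISCHARGE NO DATE).  HONEST DEPENDENCY: continuum
YM on T⁴ ⇐ BetaPertH ∧ nine spine estimates (0/9 proved); BetaPertH ⇐ (D1) ∧ (D4) ∧ CAP+tail; G-an2-4 gates asym, D1 and NE2/3/4.

THE POINT (census sense (α); route (N); README `g64/e73` §5).  A member of the constant-coefficient spike with load `h` at state (compounding `E`, consumed load
`t`) has rate `μ₀ = (a + θE)∕(D − κt)` and compounding factor `(1 − hμ₀)⁻¹`.  Split it into two consecutive pieces `h = h₁ + h₂`: the second piece is charged at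
the UPDATED rate `μ₁ = (a + θE₁)∕(D − κt − κh₁)`, `E₁ = E∕(1 − h₁μ₀)`.  §1 **`rate_gain_of_split`**: `μ₁(1 − h₁μ₀) − μ₀ = h₁(a + θE)(κ − a)∕((D − κt)(D − κt − κh₁))`
— an IDENTITY; hence for `κ ≥ a` (the Riccati condition of (E73a)) `μ₁(1 − h₁μ₀) ≥ μ₀` (`rate_succ_ge`), **`split_factor_le`**: `(1 − h₁μ₀)(1 − h₂μ₁) ≤ 1 − (h₁ + h₂)μ₀`,
and **`compounding_le_split`**: `(1 − (h₁+h₂)μ₀)⁻¹ ≤ (1 − h₁μ₀)⁻¹(1 − h₂μ₁)⁻¹` — REFINING A MEMBER NEVER DECREASES THE COMPOUNDING (and, every later rate being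
non-decreasing in the compounding, never decreases anything downstream — the majorant principle (E72a)).  With (E73a) (`spike_le_fluid`: every subdivision is
below the fluid) the fluid is the SUPREMUM of the constant-coefficient spike over subdivisions of a given load.  CONSEQUENCE FOR THE NUMERICS OF RECORD (README
`g64/e73` §5, kit job j305125): in the budget-form chain a dense cluster occupying a FIXED ratio window `(1, 1+w]` above a young age `z` has `≈ w·z` members, so its
compounding INCREASES WITH `z` towards the fluid value — finite-`z` adversarial suprema (g63: `z ≤ 60` globally) UNDER-estimate the continuum ones; measured
(t48, one fixed profile at the feasibility boundary): compounding `E = 12.3 (z = 48), 29.9 (192), 41.3 (384)`, chain load seen by the young `V = 5.7, 14.9, 20.9`.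
NOT CLAIMED: anything about positions (this is the constant-coefficient model), (S1), the near-window lemmas, MONO, anything nonlinear, anything printed.
-/
noncomputable section

namespace Summit.QuantumFields.BalabanUV.Beta.EriceRemainderEnclosureHistoryAutonomyComparisonAgeCompositionStaticChainRefinement

/-! ## §1 Splitting a member: the rate gain identity and refinement monotonicity -/

/-- **THE RATE GAIN OF A SPLIT (identity).**  With `μ₀ = (a + θE)∕(D − κt)`, `E₁ = E∕(1 − h₁μ₀)`, `μ₁ = (a + θE₁)∕(D − κt − κh₁)` (denominators non-zero,
`1 − h₁μ₀ ≠ 0`): `μ₁·(1 − h₁μ₀) − μ₀ = h₁·(a + θE)·(κ − a)∕((D − κt)·(D − κt − κh₁))`.  The sign of `κ − a` alone decides whether the second piece of a split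
member is charged more than the unsplit rate predicts. [folklore] -/
theorem rate_gain_of_split {a θ κ D t E h₁ μ₀ μ₁ E₁ : ℝ} (hQ : D - κ * t ≠ 0) (hQ₁ : D - κ * t - κ * h₁ ≠ 0) (h1 : 1 - h₁ * μ₀ ≠ 0)
    (hμ₀ : μ₀ = (a + θ * E) / (D - κ * t)) (hE₁ : E₁ = E / (1 - h₁ * μ₀)) (hμ₁ : μ₁ = (a + θ * E₁) / (D - κ * t - κ * h₁)) :
    μ₁ * (1 - h₁ * μ₀) - μ₀ = h₁ * (a + θ * E) * (κ - a) / ((D - κ * t) * (D - κ * t - κ * h₁)) := by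
  -- eliminate `E₁`, then `μ₀`
  have e1 : μ₁ * (1 - h₁ * μ₀) = (a * (1 - h₁ * μ₀) + θ * E) / (D - κ * t - κ * h₁) := by
    rw [hμ₁, hE₁]
    field_simp
  rw [e1, hμ₀, div_sub_div _ _ hQ₁ hQ, div_eq_div_iff (mul_ne_zero hQ₁ hQ) (mul_ne_zero hQ hQ₁)]
  field_simp
  ring

/-- **THE SECOND PIECE IS CHARGED MORE (`κ ≥ a`).**  In the setting of `rate_gain_of_split` with positive denominators, `a + θE ≥ 0`, `h₁ ≥ 0` and `a ≤ κ`: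
`μ₀ ≤ μ₁·(1 − h₁μ₀)`. [folklore] -/
theorem rate_succ_ge {a θ κ D t E h₁ μ₀ μ₁ E₁ : ℝ} (hQ : 0 < D - κ * t) (hQ₁ : 0 < D - κ * t - κ * h₁) (h1 : h₁ * μ₀ < 1)
    (hP : 0 ≤ a + θ * E) (hh₁ : 0 ≤ h₁) (haκ : a ≤ κ)
    (hμ₀ : μ₀ = (a + θ * E) / (D - κ * t)) (hE₁ : E₁ = E / (1 - h₁ * μ₀)) (hμ₁ : μ₁ = (a + θ * E₁) / (D - κ * t - κ * h₁)) :
    μ₀ ≤ μ₁ * (1 - h₁ * μ₀) := by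
  have h := rate_gain_of_split hQ.ne' hQ₁.ne' (by linarith) hμ₀ hE₁ hμ₁
  have hnum : 0 ≤ h₁ * (a + θ * E) * (κ - a) := mul_nonneg (mul_nonneg hh₁ hP) (by linarith)
  have hfrac : 0 ≤ h₁ * (a + θ * E) * (κ - a) / ((D - κ * t) * (D - κ * t - κ * h₁)) := div_nonneg hnum (mul_pos hQ hQ₁).le
  linarith

/-- **REFINEMENT MONOTONICITY (factor form).**  Same setting, second piece `h₂ ≥ 0` (no closure hypothesis is needed in this form):
`(1 − h₁μ₀)·(1 − h₂μ₁) ≤ 1 − (h₁ + h₂)·μ₀` — two consecutive pieces leave a SMALLER survival factor than one member of the same total load charged at the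
initial rate. [folklore] -/
theorem split_factor_le {a θ κ D t E h₁ h₂ μ₀ μ₁ E₁ : ℝ} (hQ : 0 < D - κ * t) (hQ₁ : 0 < D - κ * t - κ * h₁) (h1 : h₁ * μ₀ < 1)
    (hP : 0 ≤ a + θ * E) (hh₁ : 0 ≤ h₁) (hh₂ : 0 ≤ h₂) (haκ : a ≤ κ)
    (hμ₀ : μ₀ = (a + θ * E) / (D - κ * t)) (hE₁ : E₁ = E / (1 - h₁ * μ₀)) (hμ₁ : μ₁ = (a + θ * E₁) / (D - κ * t - κ * h₁)) :
    (1 - h₁ * μ₀) * (1 - h₂ * μ₁) ≤ 1 - (h₁ + h₂) * μ₀ := by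
  have h := rate_succ_ge hQ hQ₁ h1 hP hh₁ haκ hμ₀ hE₁ hμ₁
  nlinarith [mul_le_mul_of_nonneg_left h hh₂]

/-- **REFINEMENT MONOTONICITY (compounding form).**  If moreover the unsplit member closes (`(h₁ + h₂)μ₀ < 1`) and the second piece closes (`h₂μ₁ < 1`), then
**`(1 − (h₁+h₂)μ₀)⁻¹ ≤ (1 − h₁μ₀)⁻¹·(1 − h₂μ₁)⁻¹`**: splitting a member of the constant-coefficient spike into two consecutive pieces never decreases the
compounding (`κ ≥ a`; equality iff `κ = a` or `h₁h₂ = 0`).  Iterating, every refinement of a spike compounds at least as much, and by (E73a) `spike_le_fluid` never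
more than the fluid: the fluid is the supremum over subdivisions — the continuum is the worst case. [folklore] -/
theorem compounding_le_split {a θ κ D t E h₁ h₂ μ₀ μ₁ E₁ : ℝ} (hQ : 0 < D - κ * t) (hQ₁ : 0 < D - κ * t - κ * h₁)
    (h12 : (h₁ + h₂) * μ₀ < 1) (h2 : h₂ * μ₁ < 1)
    (hP : 0 ≤ a + θ * E) (hh₁ : 0 ≤ h₁) (hh₂ : 0 ≤ h₂) (haκ : a ≤ κ)
    (hμ₀ : μ₀ = (a + θ * E) / (D - κ * t)) (hE₁ : E₁ = E / (1 - h₁ * μ₀)) (hμ₁ : μ₁ = (a + θ * E₁) / (D - κ * t - κ * h₁)) :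
    (1 - (h₁ + h₂) * μ₀)⁻¹ ≤ (1 - h₁ * μ₀)⁻¹ * (1 - h₂ * μ₁)⁻¹ := by
  have hμ₀0 : 0 ≤ μ₀ := by rw [hμ₀]; exact div_nonneg hP hQ.le
  have h1 : h₁ * μ₀ < 1 := lt_of_le_of_lt (by nlinarith [mul_nonneg hh₂ hμ₀0]) h12
  have hf := split_factor_le hQ hQ₁ h1 hP hh₁ hh₂ haκ hμ₀ hE₁ hμ₁
  have hA : 0 < 1 - (h₁ + h₂) * μ₀ := by linarith
  have hB : 0 < 1 - h₁ * μ₀ := by linarith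
  have hC : 0 < 1 - h₂ * μ₁ := by linarith
  rw [← mul_inv, inv_le_inv₀ hA (mul_pos hB hC)]
  exact hf

/-- **THE SPLIT ALSO RAISES EVERYTHING DOWNSTREAM.**  After the two pieces the compounding is `E∕((1 − h₁μ₀)(1 − h₂μ₁)) ≥ E∕(1 − (h₁+h₂)μ₀)` (for `E ≥ 0`) and the
consumed load is the same `t + h₁ + h₂`; since every later rate `(a + θE')∕(D − κt')` is non-decreasing in the compounding `E'` (`θ ≥ 0`), every later member is
charged at least as much — by (E72a)'s majorant principle the whole refined chain dominates the unrefined one.  This lemma records the one-step comparison of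
the compoundings handed to the next member. [folklore] -/
theorem compounding_after_split_ge {a θ κ D t E h₁ h₂ μ₀ μ₁ E₁ : ℝ} (hQ : 0 < D - κ * t) (hQ₁ : 0 < D - κ * t - κ * h₁)
    (h12 : (h₁ + h₂) * μ₀ < 1) (h2 : h₂ * μ₁ < 1)
    (hP : 0 ≤ a + θ * E) (hE : 0 ≤ E) (hh₁ : 0 ≤ h₁) (hh₂ : 0 ≤ h₂) (haκ : a ≤ κ)
    (hμ₀ : μ₀ = (a + θ * E) / (D - κ * t)) (hE₁ : E₁ = E / (1 - h₁ * μ₀)) (hμ₁ : μ₁ = (a + θ * E₁) / (D - κ * t - κ * h₁)) :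
    E / (1 - (h₁ + h₂) * μ₀) ≤ E₁ / (1 - h₂ * μ₁) := by
  have h := compounding_le_split hQ hQ₁ h12 h2 hP hh₁ hh₂ haκ hμ₀ hE₁ hμ₁
  rw [hE₁, div_div, div_eq_mul_inv, div_eq_mul_inv, mul_inv]
  exact mul_le_mul_of_nonneg_left h hE

end Summit.QuantumFields.BalabanUV.Beta.EriceRemainderEnclosureHistoryAutonomyComparisonAgeCompositionStaticChainRefinement

end
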